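import Summits.QuantumFields.YangMills.Theorems.BalabanUVNodesN15TwoSpacingGluingAdjointDefectGluing
import Summits.QuantumFields.YangMills.Theorems.BalabanUVNodesN15TwoSpacingGluingCutEntries
import HarnessLib

/-!
# THE GLUING STEP AT TWO LATTICE SPACINGS — ENTRY 2 OF THE ADJOINT GLUED OPERATOR WITH RIGHT-LOCALITY DEFECTS FROM CUT ∕ SANDWICHED ROWS: FILE 147 §4 with the cube's right entry
# entering only SANDWICHED, `(M_{χ_□}G_□)∘E∘M_{h^s_□} = T₂,□∘M_{h^s_□}` (FILE 83's device), one grid and two grids (dag-n15-c g18, FILE 149; N15 = NE2, s1 «background-layer OPERATOR ingredient»)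

Cell `pub-ymgap`, seat `pub-ymgap-dag-n15-c` (R134 (a); HUMAN RULING D-0062), generation 18.  `bears_on: R4∕N15 · K3⁸ SpineGivenEndpointR13SepCoPHV (stmt-QuantumFields-27366)`.
Filed `--kind proof --supports stmt-QuantumFields-27366 --as helper` — COUNT-NEUTRAL.  Theorems only; 0 `def`, 0 `sorry`.  Imports BY NAME FILE 147 `…TwoSpacingGluingAdjointDefectGluing`
(`hasMaj_remainderLD`, `hasMaj_idef_remainderLD`, `hasMaj_neumannR_comp`; through it FILE 44 `glueInvL`, `hasMaj_idef_glueInvL_comp`) and FILE 83 `…TwoSpacingGluingCutEntries`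
(`hasMaj_parametrix_comp_cut`, `hasMaj_idef_parametrix_comp_cut`).  Nothing in the tree is modified.

WHY.  At the cover the dressed cube's right entry `X∘E` (`E = ∇*`-type) is available only SANDWICHED: by FILE 148 `X∘Q = Ñ_𝒲∘(G₀∘Q)` with `G₀ = M_χ̃N_□`, and the Neumann-by-images cube
`N_□ = Sym∘G∘M_{χ°}` has right first-order entries only behind an interior multiplier, `N_□∘∇^±_μ∘M_g = T^±_μ∘M_g` (dag-n15-a N-IIn (a)±: a derivative does not commute with the source cut).
In the adjoint-dressed parametrix `G₀∘E = Σ_□[M_{h_□}(G_□∘E)M_{h^s_□} + M_{h_□}G_□M_{dh_□}]` the right entry only ever meets `M_{h^s_□}` (`h^s = h∘τ`, supported inside `□` with its margin), so the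
sandwiched identity suffices — FILE 83 typed exactly this for the right-dressed parametrix (`hasMaj_parametrix_comp_cut`).  THIS FILE is FILE 147's entry-2 gluing in that currency.

WHAT.  ★★ `hasMaj_glueInvL_parametrix_comp_cut_of_defect` (one grid): adjoint Leibniz `M_h∘E = E∘M_{h^s} + M_{dh}`, cut `M_hM_χ = M_h`, sandwiched identity `(M_χG_□)∘E∘M_{h^s} = T₂∘M_{h^s}`
with `T₂ ≤ 1_S1_Sβ₂`, cut rows `M_χG_□ ≤ 1_S1_Sβ`, adjoint commutator rows `G_□∘[Δ, M_h] ≤ 1_S1_Sθ₀`, right-locality defect rows `Ẽ_□ ≤ 1_S1_Sε`, `N_ov(θ₀+ε)c_r < 1`, `2σ ≤ δ` ⟹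
`glueInvL (R̃ − Σ_□M_hẼ_□) (Σ_□M_hG_□M_h) ∘ E ≤ (1 − N_ov(θ₀+ε)c_r)⁻¹N_ov(β₂c_s + βc_d)c_r·e^{−(δ−2σ)d}`; ★★★ `hasMaj_idef_glueInvL_parametrix_comp_cut_of_defect` (two grids): the same at
both spacings + the fits `o, o_s, o_d` + the two-grid defects of the cut rows (`m₀`), of the sandwiched operators (`m₂`), of the adjoint commutator rows (`r`), of the defect rows (`r_E`) ⟹
`𝔇_π ≤ [(1−q)⁻¹m̂c_r + (1−q)⁻¹(r̂((1−q)⁻¹Âc_r)c_r)c_r]·e^{−(δ−2σ)d}` (FILE 147's constant, `Â = N_ov(β₂c_s + βc_d)`, `r̂ = N_ov(r + oθ₀ + r_E + oε)`, `m̂` = FILE 83's).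

HONEST FRAMING ∕ LIMITS.  Generic block-majorant bookkeeping; every row is a HYPOTHESIS (instantiation for the live dressed cubes at the cover = the located next step); (2.36)–(2.37),
(2.91)–(2.93), (2.133)–(2.136) of [Balaban1984PropagatorsII] and (3.42), Thm 3.14 of [Balaban1985BackgroundPropagators] are SHAPES ∕ MECHANISM ∕ TEMPLATE; nothing of [B5]∕[B6]∕[B9]
asserted.  NE2⁺ NOT PRINTED, NOT proved; N15 NOT discharged; K3⁸ OPEN, skeleton v7 untouched (0∕2); counts of record UNMOVED (typed 28∕28 · discharged 6∕27 · A 6∕28); one finite 𝕋⁴ at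
fixed ε — NOT infinite volume, NOT OS on ℝ⁴, NOT a mass gap, NOT Clay; R4 closes the conditional finite-𝕋⁴ rung `BalabanLadder.UV` only.  Restate-immune (no Theses import).
-/

noncomputable section

open scoped BigOperators

namespace Summit.QuantumFields.YangMills.BalabanUVNodes.N15.Gluing

open Literature.MathematicalPhysics.QuantumFieldTheory.Balaban1983to89
open Literature.MathematicalPhysics.QuantumFieldTheory.Balaban1983to89.B11SectG (BlockNorm HasMaj RowSum)
open Literature.MathematicalPhysics.QuantumFieldTheory.Balaban1983to89.B6RandomWalk (Triangle254)
open Literature.MathematicalPhysics.QuantumFieldTheory.Balaban1983to89.T4EtaRateDefect (idef)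
open Literature.MathematicalPhysics.QuantumFieldTheory.Balaban1983to89.T4EtaRateCoeffDefect (pull)
open Literature.MathematicalPhysics.QuantumFieldTheory.Balaban1983to89.B6Prop26Gluing (mulOp ind ind_nonneg)

variable {X X' : Type} [Fintype X] [Fintype X'] [DecidableEq X] [DecidableEq X'] {ι : Type} [Fintype ι] {g : B6.Geometry} (blk : X → g.Site) (π : X' → X)
  (S : ι → Set g.Site) {σ cr : ℝ}

omit [Fintype X'] [DecidableEq X'] in
/-- ★★ **ENTRY 2 OF THE ADJOINT GLUED OPERATOR WITH DEFECTS, FROM CUT ∕ SANDWICHED ROWS, ONE GRID**: adjoint Leibniz `M_{h_□}∘E = E∘M_{h^s_□} + M_{dh_□}` (`|h| ≤ 1`, `|h^s| ≤ c_s`,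
`|dh| ≤ c_d`), cut `M_{h_□}M_{χ_□} = M_{h_□}`, the SANDWICHED right entry `(M_{χ_□}G_□)∘E∘M_{h^s_□} = T₂,□∘M_{h^s_□}` with `T₂,□ ≤ 1_S1_S·β₂e^{−δd}`, cut rows `M_{χ_□}G_□ ≤ 1_S1_S·βe^{−δd}`, adjoint
commutator rows `G_□∘[Δ, M_{h_□}] ≤ 1_S1_S·θ₀e^{−δd}`, right-locality defect rows `Ẽ_□ ≤ 1_S1_S·εe^{−δd}`, overlap `N_ov`, `N_ov(θ₀ + ε)c_r < 1`, `2σ ≤ δ` ⟹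
`glueInvL (R̃ − Σ_□M_{h_□}Ẽ_□) (Σ_□M_hG_□M_h) ∘ E ≤ (1 − N_ov(θ₀+ε)c_r)⁻¹·N_ov(β₂c_s + βc_d)·c_r·e^{−(δ−2σ)d}`.
[cite: Balaban1984PropagatorsII, (2.37) p.229, (2.91)–(2.93) p.239, Prop. 2.6 (2.133)–(2.136) p.247 (shapes + mechanism, transposed); Balaban1985BackgroundPropagators, (3.42) p.397 (entry `G∇*_U`: shape)] -/
theorem hasMaj_glueInvL_parametrix_comp_cut_of_defect (htri : Triangle254 g) (hd : ∀ a b : g.Site, 0 ≤ g.dist a b) (hd0 : ∀ y : g.Site, g.dist y y = 0) (hrow : RowSum g σ cr)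
    (hσ : 0 ≤ σ) {Δ E : (X → ℝ) →ₗ[ℝ] (X → ℝ)} {h hs dh χ : ι → X → ℝ} {G T₂ Ed : ι → (X → ℝ) →ₗ[ℝ] (X → ℝ)} {β β₂ cs cd θ₀ ε δ Nov : ℝ} (hβ : 0 ≤ β) (hβ₂ : 0 ≤ β₂)
    (hcs : 0 ≤ cs) (hcd : 0 ≤ cd) (hθ : 0 ≤ θ₀) (hε : 0 ≤ ε) (hNov : 0 ≤ Nov) (hσδ : 2 * σ ≤ δ) (hleib : ∀ i, mulOp (h i) ∘ₗ E = E ∘ₗ mulOp (hs i) + mulOp (dh i))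
    (hcut : ∀ i, mulOp (h i) ∘ₗ mulOp (χ i) = mulOp (h i)) (hE2 : ∀ i, mulOp (χ i) ∘ₗ G i ∘ₗ E ∘ₗ mulOp (hs i) = T₂ i ∘ₗ mulOp (hs i))
    (hh : ∀ i x, |h i x| ≤ 1) (hhs : ∀ i x, |hs i x| ≤ cs) (hdh : ∀ i x, |dh i x| ≤ cd) (hN : ∀ a, ∑ i, ind (S i) a ≤ Nov)
    (hGc : ∀ i, HasMaj (BlockNorm.ofBlocks g blk) (BlockNorm.ofBlocks g blk) (mulOp (χ i) ∘ₗ G i) (fun y y' => ind (S i) y * ind (S i) y' * (β * Real.exp (-(δ * g.dist y y')))))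
    (hT2 : ∀ i, HasMaj (BlockNorm.ofBlocks g blk) (BlockNorm.ofBlocks g blk) (T₂ i) (fun y y' => ind (S i) y * ind (S i) y' * (β₂ * Real.exp (-(δ * g.dist y y')))))
    (hKc : ∀ i, HasMaj (BlockNorm.ofBlocks g blk) (BlockNorm.ofBlocks g blk) (G i ∘ₗ commOp Δ (h i)) (fun y y' => ind (S i) y * ind (S i) y' * (θ₀ * Real.exp (-(δ * g.dist y y')))))
    (hEd : ∀ i, HasMaj (BlockNorm.ofBlocks g blk) (BlockNorm.ofBlocks g blk) (Ed i) (fun y y' => ind (S i) y * ind (S i) y' * (ε * Real.exp (-(δ * g.dist y y')))))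
    (hq : Nov * (θ₀ + ε) * cr < 1) :
    HasMaj (BlockNorm.ofBlocks g blk) (BlockNorm.ofBlocks g blk) (glueInvL (remainderL Δ h G - ∑ i, mulOp (h i) ∘ₗ Ed i) (parametrix h G) ∘ₗ E)
      (fun y y' => (1 - Nov * (θ₀ + ε) * cr)⁻¹ * (Nov * (β₂ * cs + β * cd)) * cr * Real.exp (-((δ - 2 * σ) * g.dist y y'))) := by
  have hP := hasMaj_parametrix_comp_cut blk S hβ hβ₂ hcs hcd hleib hcut hE2 hh hhs hdh hN hGc hT2
  rw [glueInvL, LinearMap.comp_assoc]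
  exact hasMaj_neumannR_comp blk htri hd hd0 hrow hσ (by positivity) (mul_nonneg hNov (add_nonneg hθ hε)) hσδ hP (hasMaj_remainderLD blk S hθ hε hh hN hKc hEd) hq

/-- ★★★ **… AND ITS TWO-SPACING η-DEFECT, FROM CUT ∕ SANDWICHED ROWS** (two grids along `π`): the one-grid data at both spacings, the partition fits `o, o_s, o_d`, and the per-cube two-grid
defects of the cut rows (`m₀`), of the sandwiched operators `𝔇(T₂′,□, T₂,□)` (`m₂`), of the adjoint commutator rows (`r`), of the defect rows (`r_E`) ⟹ `𝔇_π(Ñ′∘(G₀′∘E′), Ñ∘(G₀∘E)) ≤ […]·e^{−(δ−2σ)d}`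
with FILE 147's constant. [cite: Balaban1985BackgroundPropagators, Thm 3.14 pp.426–427 (difference template), (3.42) p.397; Balaban1984PropagatorsII, (2.91)–(2.93) p.239, (2.133)–(2.136) p.247] -/
theorem hasMaj_idef_glueInvL_parametrix_comp_cut_of_defect (htri : Triangle254 g) (hd : ∀ a b : g.Site, 0 ≤ g.dist a b) (hd0 : ∀ y : g.Site, g.dist y y = 0) (hrow : RowSum g σ cr)
    (hσ : 0 ≤ σ) (hcr : 0 ≤ cr) {Δ E : (X → ℝ) →ₗ[ℝ] (X → ℝ)} {Δ' E' : (X' → ℝ) →ₗ[ℝ] (X' → ℝ)} {h hs dh χ : ι → X → ℝ} {h' hs' dh' χ' : ι → X' → ℝ}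
    {G T₂ Ed : ι → (X → ℝ) →ₗ[ℝ] (X → ℝ)} {G' T₂' Ed' : ι → (X' → ℝ) →ₗ[ℝ] (X' → ℝ)} {β β₂ cs cd o os od m₀ m₂ θ₀ ε r rE δ Nov : ℝ} (hβ : 0 ≤ β) (hβ₂ : 0 ≤ β₂) (hcs : 0 ≤ cs)
    (hcd : 0 ≤ cd) (ho : 0 ≤ o) (hos : 0 ≤ os) (hod : 0 ≤ od) (hm₀ : 0 ≤ m₀) (hm₂ : 0 ≤ m₂) (hθ : 0 ≤ θ₀) (hε : 0 ≤ ε) (hr : 0 ≤ r) (hrE : 0 ≤ rE) (hNov : 0 ≤ Nov) (hσδ : 2 * σ ≤ δ)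
    (hleib : ∀ i, mulOp (h i) ∘ₗ E = E ∘ₗ mulOp (hs i) + mulOp (dh i)) (hleib' : ∀ i, mulOp (h' i) ∘ₗ E' = E' ∘ₗ mulOp (hs' i) + mulOp (dh' i))
    (hcut : ∀ i, mulOp (h i) ∘ₗ mulOp (χ i) = mulOp (h i)) (hcut' : ∀ i, mulOp (h' i) ∘ₗ mulOp (χ' i) = mulOp (h' i))
    (hE2 : ∀ i, mulOp (χ i) ∘ₗ G i ∘ₗ E ∘ₗ mulOp (hs i) = T₂ i ∘ₗ mulOp (hs i)) (hE2' : ∀ i, mulOp (χ' i) ∘ₗ G' i ∘ₗ E' ∘ₗ mulOp (hs' i) = T₂' i ∘ₗ mulOp (hs' i))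
    (hh : ∀ i x, |h i x| ≤ 1) (hh' : ∀ i x', |h' i x'| ≤ 1) (hhs : ∀ i x, |hs i x| ≤ cs) (hdh : ∀ i x, |dh i x| ≤ cd)
    (hfit : ∀ i x', |h' i x' - h i (π x')| ≤ o) (hfits : ∀ i x', |hs' i x' - hs i (π x')| ≤ os) (hfitd : ∀ i x', |dh' i x' - dh i (π x')| ≤ od) (hN : ∀ b, ∑ i, ind (S i) b ≤ Nov)
    (hGc : ∀ i, HasMaj (BlockNorm.ofBlocks g blk) (BlockNorm.ofBlocks g blk) (mulOp (χ i) ∘ₗ G i) (fun y y' => ind (S i) y * ind (S i) y' * (β * Real.exp (-(δ * g.dist y y')))))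
    (hGc' : ∀ i, HasMaj (BlockNorm.ofBlocks g (blk ∘ π)) (BlockNorm.ofBlocks g (blk ∘ π)) (mulOp (χ' i) ∘ₗ G' i)
      (fun y y' => ind (S i) y * ind (S i) y' * (β * Real.exp (-(δ * g.dist y y')))))
    (hT2 : ∀ i, HasMaj (BlockNorm.ofBlocks g blk) (BlockNorm.ofBlocks g blk) (T₂ i) (fun y y' => ind (S i) y * ind (S i) y' * (β₂ * Real.exp (-(δ * g.dist y y')))))
    (hT2' : ∀ i, HasMaj (BlockNorm.ofBlocks g (blk ∘ π)) (BlockNorm.ofBlocks g (blk ∘ π)) (T₂' i) (fun y y' => ind (S i) y * ind (S i) y' * (β₂ * Real.exp (-(δ * g.dist y y')))))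
    (hIGc : ∀ i, HasMaj (BlockNorm.ofBlocks g blk) (BlockNorm.ofBlocks g (blk ∘ π)) (idef (pull π) (pull π) (mulOp (χ' i) ∘ₗ G' i) (mulOp (χ i) ∘ₗ G i))
      (fun y y' => ind (S i) y * ind (S i) y' * (m₀ * Real.exp (-(δ * g.dist y y')))))
    (hIT2 : ∀ i, HasMaj (BlockNorm.ofBlocks g blk) (BlockNorm.ofBlocks g (blk ∘ π)) (idef (pull π) (pull π) (T₂' i) (T₂ i))
      (fun y y' => ind (S i) y * ind (S i) y' * (m₂ * Real.exp (-(δ * g.dist y y')))))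
    (hKc : ∀ i, HasMaj (BlockNorm.ofBlocks g blk) (BlockNorm.ofBlocks g blk) (G i ∘ₗ commOp Δ (h i)) (fun y y' => ind (S i) y * ind (S i) y' * (θ₀ * Real.exp (-(δ * g.dist y y')))))
    (hKc' : ∀ i, HasMaj (BlockNorm.ofBlocks g (blk ∘ π)) (BlockNorm.ofBlocks g (blk ∘ π)) (G' i ∘ₗ commOp Δ' (h' i))
      (fun y y' => ind (S i) y * ind (S i) y' * (θ₀ * Real.exp (-(δ * g.dist y y')))))
    (hDK : ∀ i, HasMaj (BlockNorm.ofBlocks g blk) (BlockNorm.ofBlocks g (blk ∘ π)) (idef (pull π) (pull π) (G' i ∘ₗ commOp Δ' (h' i)) (G i ∘ₗ commOp Δ (h i)))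
      (fun y y' => ind (S i) y * ind (S i) y' * (r * Real.exp (-(δ * g.dist y y')))))
    (hEd : ∀ i, HasMaj (BlockNorm.ofBlocks g blk) (BlockNorm.ofBlocks g blk) (Ed i) (fun y y' => ind (S i) y * ind (S i) y' * (ε * Real.exp (-(δ * g.dist y y')))))
    (hEd' : ∀ i, HasMaj (BlockNorm.ofBlocks g (blk ∘ π)) (BlockNorm.ofBlocks g (blk ∘ π)) (Ed' i) (fun y y' => ind (S i) y * ind (S i) y' * (ε * Real.exp (-(δ * g.dist y y')))))
    (hDEd : ∀ i, HasMaj (BlockNorm.ofBlocks g blk) (BlockNorm.ofBlocks g (blk ∘ π)) (idef (pull π) (pull π) (Ed' i) (Ed i)) (fun y y' => ind (S i) y * ind (S i) y' * (rE * Real.exp (-(δ * g.dist y y')))))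
    (hq : Nov * (θ₀ + ε) * cr < 1) :
    HasMaj (BlockNorm.ofBlocks g blk) (BlockNorm.ofBlocks g (blk ∘ π))
      (idef (pull π) (pull π) (glueInvL (remainderL Δ' h' G' - ∑ i, mulOp (h' i) ∘ₗ Ed' i) (parametrix h' G') ∘ₗ E')
        (glueInvL (remainderL Δ h G - ∑ i, mulOp (h i) ∘ₗ Ed i) (parametrix h G) ∘ₗ E))
      (fun y y' => ((1 - Nov * (θ₀ + ε) * cr)⁻¹ * (Nov * ((1 * β₂ * os + 1 * m₂ * cs + o * β₂ * cs) + (1 * β * od + 1 * m₀ * cd + o * β * cd))) * cr +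
          (1 - Nov * (θ₀ + ε) * cr)⁻¹ * ((Nov * (1 * r + o * θ₀ + (1 * rE + o * ε))) * ((1 - Nov * (θ₀ + ε) * cr)⁻¹ * (Nov * (β₂ * cs + β * cd)) * cr) * cr) * cr) *
        Real.exp (-((δ - 2 * σ) * g.dist y y'))) := by
  have hP := hasMaj_parametrix_comp_cut blk S hβ hβ₂ hcs hcd hleib hcut hE2 hh hhs hdh hN hGc hT2
  have hIP := hasMaj_idef_parametrix_comp_cut blk π S hβ hβ₂ hcs hcd ho hos hod hm₀ hm₂ hleib hleib' hcut hcut' hE2 hE2' hh' hhs hdh hfit hfits hfitd hN hGc hGc' hT2 hT2' hIGc hIT2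
  rw [glueInvL, glueInvL, LinearMap.comp_assoc, LinearMap.comp_assoc]
  exact hasMaj_idef_glueInvL_comp blk π htri hd hd0 hrow hσ hcr (by positivity) (mul_nonneg hNov (add_nonneg hθ hε)) (mul_nonneg hNov (by positivity)) (mul_nonneg hNov (by positivity)) hσδ hP
    (hasMaj_remainderLD blk S hθ hε hh hN hKc hEd) (hasMaj_remainderLD (blk ∘ π) S hθ hε hh' hN hKc' hEd') hIP
    (hasMaj_idef_remainderLD blk π S hθ hr hε hrE ho hh' hfit hN hKc hDK hEd hDEd) hq

end Summit.QuantumFields.YangMills.BalabanUVNodes.N15.Gluing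

end
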